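import Mathlib
import Summits.NavierStokesRegularity.NavierStokesRegularity.Theorems.ThreadingFluxHorizonTowerFiniteTowerThirdShell
import Summits.NavierStokesRegularity.NavierStokesRegularity.Theorems.ThreadingFluxHorizonTowerFiniteTowerByName
import HarnessLib

/-!
# Crux `PoloidalLiouville` (stmt-NavierStokesRegularity-1222), crux idea «horizon-threading-tower» (ns-idea-15):
# FINITE TOWERS AT ORDER ONE — THM C″: TOP PAIR OF OPPOSITE PARITY, ISOLATED COMPANION OF THE SECOND SHELL

Support file (`--supports stmt-NavierStokesRegularity-1222`, helper; cell `ns-wall-extremal`, width hand ns-wall-eng-3 g5; 0 kit).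

Third member of the «two isolated pairs» family (THM C: same-parity top pair + largest opposite-parity degree `a`, pair `(a, D)`;
THM C′: opposite-parity top pair + largest same-parity-as-`D` degree `a`, pair `(a, D)`).  Here the two largest degrees `D′ < D` have
OPPOSITE parity and the second isolated pair hangs off the SECOND shell: `b` is the largest degree `≠ D′` of the parity of `D′`, and the
pair `(b, D′)` is the top of the even-sum parity class as soon as `a + D < b + D′` for every degree `a ≠ D` of the parity of `D` (e.g.
`{2, 4, 6, 9}`: top pair `(6, 9)`, `b = 4`, no odd degree below `9`).  Then `f_b^{D′} ∝ f_{D′}^b` and `g^{D′} ∝ f_{D′}^D` for the null-cone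
charts, and `gcd(D′, b, D) = 1` makes every root multiplicity of the SECOND chart `f_{D′}` divisible by `D′`: the second shell is zonal about a
real axis, hence so is the top shell (`finiteTower_top_detP_lin_eq_zero_of_second`, THM A′) and THM A descends.

* ★★ `finiteTower_zonal_of_oppositeParityBelow` (THM C″).  Covers `{2,4,6,9}` (`b = 4`, no odd degree below `9`, `gcd(9,6,4) = 1`),
  `{2,4,6,8,11}` (`b = 6`), `{4,6,8,13}`; NOT `{1,2,4,6,9}` (`1 + 9 = 4 + 6`: the pair `(4,6)` ties with `(1,9)` and is not isolated).

HONEST LABEL: special cases of the crux-idea conjecture `HorizonTowerZonality` (order one; side condition on three shells); general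
towers, `PoloidalLiouville` (1222) OPEN; W1 movement 0; NS regularity NOT proved.  [folklore]
-/

-- the summit and its single sub-problem share the name (CONVENTIONS §1)
set_option linter.dupNamespace false

noncomputable section

open MvPolynomial Complex
open scoped Polynomial RealInnerProductSpace
open Literature.Analysis.FluidPDE (cross)

namespace Summit.NavierStokesRegularity.NavierStokesRegularity.Theorems.PoloidalLiouville.HorizonTower

section OppositeBelow

variable (K : Finset ℕ) (H : ℕ → E3 → ℝ)

/-- **THM C″, polynomial level.**  `D = max K`, `D′` the second largest degree with `D′ ≢ D (mod 2)`, `b ∈ K` the largest degree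
`≠ D′` of the parity of `D′`, `a + D < b + D′` for every degree `a ≠ D` of the parity of `D`; `P_D, P_{D′}, P_b ≠ 0`;
`Nat.Coprime D (Nat.gcd D′ b)` ⇒ the top shell is annihilated by the rotation derivative about some real axis. [folklore] -/
theorem finiteTower_exists_axis_of_oppositeParityBelow (hK : ∀ l ∈ K, 1 ≤ l) (hH : ∀ l ∈ K, ContDiff ℝ (⊤ : ℕ∞) (H l))
    (hhom : ∀ l ∈ K, ∀ (c : ℝ) (y : E3), H l (c • y) = c ^ l * H l y)
    (hharm : ∀ l ∈ K, ∀ y, Laplacian.laplacian (H l) y = 0)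
    (hL1 : ∀ x : E3, x ≠ 0 → horizonL1 (fun z => ∑ l ∈ K, horizonProfile l (H l) 0 z) 0 x = 0)
    (P : ℕ → MvPolynomial (Fin 3) ℝ)
    (hP : ∀ l ∈ K, (P l).IsHomogeneous l ∧ Zonal.lapP (P l) = 0 ∧ ∀ y, H l y = Zonal.evalE (P l) y)
    {D D' b : ℕ} (hD : D ∈ K) (hD' : D' ∈ K) (hlt : D' < D) (hmax : ∀ l ∈ K, l ≤ D) (hsec : ∀ l ∈ K, l ≠ D → l ≤ D')
    (hpar : D' % 2 ≠ D % 2) (hbK : b ∈ K) (hbD' : b ≠ D') (hbpar : b % 2 = D' % 2)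
    (hbmax : ∀ l ∈ K, l ≠ D' → l % 2 = D' % 2 → l ≤ b)
    (hiso' : ∀ a ∈ K, a ≠ D → a % 2 = D % 2 → a + D < b + D')
    (hcop : Nat.Coprime D (Nat.gcd D' b)) (hPD : P D ≠ 0) (hPD' : P D' ≠ 0) (hPb : P b ≠ 0) :
    ∃ n : Fin 3 → ℝ, n ≠ 0 ∧ Zonal.detP (C (n 0) * X 0 + C (n 1) * X 1 + C (n 2) * X 2) (P D) = 0 := by
  have hbD : b ≠ D := fun h => hpar (by rw [← hbpar, h])
  have hblt : b < D' := lt_of_le_of_ne (hsec b hbK hbD) hbD'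
  -- `(b, D′)` is isolated inside its parity class
  have hiso := finiteTower_chartT_detP_eq_zero_of_class K H hK hH hhom hharm hL1 P (fun l hl => (hP l hl).2.2) hbK hD' hbD' (by
    intro j hj k hk hjk hsum hcls h1 h2
    exfalso
    have hjD := hmax j hj
    have hkD := hmax k hk
    rcases eq_or_ne k D with rfl | hkne
    · -- `(j, D)` with `j ≡ D`: excluded by `hiso'`
      have hjp : j % 2 = k % 2 := by omega
      have := hiso' j hj hjk hjp
      omega
    · rcases eq_or_ne j D with rfl | hjne
      · have hkp : k % 2 = j % 2 := by omega
        have := hiso' k hk hjk.symm hkp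
        omega
      · have hk' := hsec k hk hkne
        have hj' := hsec j hj hjne
        rcases eq_or_ne k D' with rfl | hkne'
        · -- `(j, D′)`: `j ≥ b`, `j ≡ D′` ⇒ `j = b`
          have hjp : j % 2 = k % 2 := by omega
          have := hbmax j hj hjk hjp
          exact h1 ⟨by omega, rfl⟩
        · rcases eq_or_ne j D' with rfl | hjne'
          · have hkp : k % 2 = j % 2 := by omega
            have := hbmax k hk hjk.symm hkp
            exact h2 ⟨rfl, by omega⟩
          · -- both below `D′`
            have hk'' : k < D' := lt_of_le_of_ne hk' hkne'
            have hj'' : j < D' := lt_of_le_of_ne hj' hjne'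
            by_cases hjp : j % 2 = D' % 2
            · have := hbmax j hj hjne' hjp
              omega
            · have hjq : j % 2 = D % 2 := by omega
              have := hiso' j hj hjne hjq
              omega)
  -- charts
  set fb : ℂ[X] := Zonal.chartT (map (algebraMap ℝ ℂ) (P b)) with hfb
  set fD' : ℂ[X] := Zonal.chartT (map (algebraMap ℝ ℂ) (P D')) with hfD'
  set g : ℂ[X] := Zonal.chartT (map (algebraMap ℝ ℂ) (P D)) with hg
  have hfb0 : fb ≠ 0 := fun h => hPb (Zonal.eq_zero_of_chartT_map_eq_zero (hP b hbK).1 (hP b hbK).2.1 h)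
  have hfD'0 : fD' ≠ 0 := fun h => hPD' (Zonal.eq_zero_of_chartT_map_eq_zero (hP D' hD').1 (hP D' hD').2.1 h)
  have hg0 : g ≠ 0 := fun h => hPD (Zonal.eq_zero_of_chartT_map_eq_zero (hP D hD).1 (hP D hD).2.1 h)
  -- the weighted Wronskian laws `b·fb·fD′′ = D′·fD′·fb′` and `D′·fD′·g′ = D·g·fD′′`
  have hWb : (b : ℂ[X]) * fb * Polynomial.derivative fD' = (D' : ℂ[X]) * fD' * Polynomial.derivative fb := by
    have h := Zonal.chartT_detP (((hP b hbK).1).map (algebraMap ℝ ℂ)) (((hP D' hD').1).map (algebraMap ℝ ℂ))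
    rw [← Zonal.map_detP, hiso, mul_zero] at h
    exact sub_eq_zero.mp h.symm
  have hWD' := finiteTower_top_wronskian K H hK hH hhom hharm hL1 P (fun l hl => ⟨(hP l hl).1, (hP l hl).2.2⟩) hD hD' hlt
    hmax hsec
  obtain ⟨c₁, hc₁⟩ := Zonal.exists_C_mul_of_wronskian_eq_zero (pow_ne_zero _ hfD'0)
    (Zonal.wronskian_pow_pow_eq_zero (hK b hbK) (hK D' hD') hWb)
  have hWr := Zonal.wronskian_pow_pow_eq_zero (hK D' hD') (hK D hD) hWD'
  rw [← Polynomial.wronskian_neg_eq, neg_eq_zero] at hWr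
  obtain ⟨c₂, hc₂⟩ := Zonal.exists_C_mul_of_wronskian_eq_zero (pow_ne_zero _ hfD'0) hWr
  have hcop' : Nat.Coprime D' (Nat.gcd b D) := by
    have e : Nat.gcd D' (Nat.gcd b D) = Nat.gcd D (Nat.gcd D' b) := by
      rw [Nat.gcd_comm b D, ← Nat.gcd_assoc, Nat.gcd_comm D' D, Nat.gcd_assoc]
    unfold Nat.Coprime at hcop ⊢
    rw [e]; exact hcop
  obtain ⟨q, hqm, hfq, hdeg⟩ := Zonal.exists_monic_eq_C_mul_pow_of_two_rel (hK D' hD') hfb0 hg0 hc₁ hc₂ hcop'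
  have hq2 : q.natDegree ≤ 2 := by
    have h1 : fD'.natDegree ≤ 2 * D' := Zonal.natDegree_chartT_le (((hP D' hD').1).map (algebraMap ℝ ℂ))
    have h2 : D' * q.natDegree ≤ D' * 2 := by rw [hdeg, mul_comm]; exact h1
    exact Nat.le_of_mul_le_mul_left h2 (hK D' hD')
  -- the SECOND shell is zonal about a real axis, hence so is the top shell
  obtain ⟨n, hn, hsecond⟩ :=
    Zonal.exists_real_axis_of_chartT_eq_pow (hP D' hD').1 (hK D' hD') (hP D' hD').2.1 hqm.ne_zero hq2 hfq
  exact ⟨n, hn, finiteTower_top_detP_lin_eq_zero_of_second K H hK hH hhom hharm hL1 P hP hD hD' hlt hmax hsec hPD' hn hsecond⟩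

/-- ★★ **THM C″ — OPPOSITE-PARITY TOP PAIR, COMPANION OF THE SECOND SHELL.**  A finite scale-free tower of horizon profiles passing
order one whose two largest degrees `D′ < D` have OPPOSITE parity, whose largest degree `b ≠ D′` of the parity of `D′` carries a
non-zero shell (as do `D`, `D′`), with `a + D < b + D′` for every degree `a ≠ D` of the parity of `D`, and with `gcd(D, D′, b) = 1`, is
COAXIALLY ZONAL. [folklore] -/
theorem finiteTower_zonal_of_oppositeParityBelow (hK : ∀ l ∈ K, 1 ≤ l) (hH : ∀ l ∈ K, ContDiff ℝ (⊤ : ℕ∞) (H l))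
    (hhom : ∀ l ∈ K, ∀ (c : ℝ) (y : E3), H l (c • y) = c ^ l * H l y)
    (hharm : ∀ l ∈ K, ∀ y, Laplacian.laplacian (H l) y = 0)
    (hL1 : ∀ x : E3, x ≠ 0 → horizonL1 (fun z => ∑ l ∈ K, horizonProfile l (H l) 0 z) 0 x = 0)
    {D D' b : ℕ} (hD : D ∈ K) (hD' : D' ∈ K) (hlt : D' < D) (hmax : ∀ l ∈ K, l ≤ D) (hsec : ∀ l ∈ K, l ≠ D → l ≤ D')
    (hpar : D' % 2 ≠ D % 2) (hbK : b ∈ K) (hbD' : b ≠ D') (hbpar : b % 2 = D' % 2)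
    (hbmax : ∀ l ∈ K, l ≠ D' → l % 2 = D' % 2 → l ≤ b)
    (hiso' : ∀ a ∈ K, a ≠ D → a % 2 = D % 2 → a + D < b + D')
    (hcop : Nat.Coprime D (Nat.gcd D' b)) (hD0 : ∃ y, H D y ≠ 0) (hD'0 : ∃ y, H D' y ≠ 0) (hb0 : ∃ y, H b y ≠ 0) :
    ∃ e : E3, e ≠ 0 ∧ ∀ l ∈ K, ∀ y : E3, ⟪cross e y, gradient (H l) y⟫ = 0 := by
  obtain ⟨P, hP⟩ := finiteTower_exists_polys K H hH hhom hharm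
  have hne : ∀ {l}, l ∈ K → (∃ y, H l y ≠ 0) → P l ≠ 0 := by
    intro l hl ⟨y, hy⟩ h
    apply hy
    rw [(hP l hl).2.2 y, h]
    simp [Zonal.evalE]
  obtain ⟨n, hn, htop⟩ := finiteTower_exists_axis_of_oppositeParityBelow K H hK hH hhom hharm hL1 P hP hD hD' hlt hmax hsec hpar
    hbK hbD' hbpar hbmax hiso' hcop (hne hD hD0) (hne hD' hD'0) (hne hbK hb0)
  have hna : (WithLp.toLp 2 n : E3) ≠ 0 := by
    intro h
    apply hn
    funext i
    have := congrArg (fun v : E3 => v i) h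
    simpa using this
  refine ⟨WithLp.toLp 2 n, hna, fun l hl y => ?_⟩
  have h := finiteTower_detP_lin_eq_zero_of_top K H hK hH hhom hharm hL1 P hP hD hmax (hne hD hD0) hn htop l hl
  rw [Zonal.detP_lin_eq_zero_iff] at h
  have := h y
  rwa [← show H l = Zonal.evalE (P l) from funext (hP l hl).2.2] at this

/-- THM C″ with the zonal functional forms. [folklore] -/
theorem finiteTower_zonalForm_of_oppositeParityBelow (hK : ∀ l ∈ K, 1 ≤ l) (hH : ∀ l ∈ K, ContDiff ℝ (⊤ : ℕ∞) (H l))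
    (hhom : ∀ l ∈ K, ∀ (c : ℝ) (y : E3), H l (c • y) = c ^ l * H l y)
    (hharm : ∀ l ∈ K, ∀ y, Laplacian.laplacian (H l) y = 0)
    (hL1 : ∀ x : E3, x ≠ 0 → horizonL1 (fun z => ∑ l ∈ K, horizonProfile l (H l) 0 z) 0 x = 0)
    {D D' b : ℕ} (hD : D ∈ K) (hD' : D' ∈ K) (hlt : D' < D) (hmax : ∀ l ∈ K, l ≤ D) (hsec : ∀ l ∈ K, l ≠ D → l ≤ D')
    (hpar : D' % 2 ≠ D % 2) (hbK : b ∈ K) (hbD' : b ≠ D') (hbpar : b % 2 = D' % 2)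
    (hbmax : ∀ l ∈ K, l ≠ D' → l % 2 = D' % 2 → l ≤ b)
    (hiso' : ∀ a ∈ K, a ≠ D → a % 2 = D % 2 → a + D < b + D')
    (hcop : Nat.Coprime D (Nat.gcd D' b)) (hD0 : ∃ y, H D y ≠ 0) (hD'0 : ∃ y, H D' y ≠ 0) (hb0 : ∃ y, H b y ≠ 0) :
    ∃ e : E3, e ≠ 0 ∧ ∀ l ∈ K, ∃ g : ℝ → ℝ, ∀ y : E3, y ≠ 0 → H l y = ‖y‖ ^ l * g (⟪e, y⟫ / ‖y‖) := by
  obtain ⟨e, he, hrot⟩ := finiteTower_zonal_of_oppositeParityBelow K H hK hH hhom hharm hL1 hD hD' hlt hmax hsec hpar hbK hbD' hbpar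
    hbmax hiso' hcop hD0 hD'0 hb0
  exact ⟨e, he, fun l hl => exists_zonalForm_of_inner_cross_gradient_eq_zero (l := l) he ((hH l hl).differentiable (by simp))
    (fun c y _ => hhom l hl c y) (hrot l hl)⟩

end OppositeBelow

end Summit.NavierStokesRegularity.NavierStokesRegularity.Theorems.PoloidalLiouville.HorizonTower

end
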